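import Summits.QuantumFields.YangMills.Theorems.BalabanUVNodesN27AtAllPinsOfRecord13CoPHVCutBFree
import Summits.QuantumFields.YangMills.Theorems.BalabanUVNodesN19RateEdgeHolderD4AtBareLedgerReadingV
import Summits.QuantumFields.YangMills.Theorems.BalabanUVNodesN18PolLimitRateOfGeometricIncrements

/-!
# ★ APBᴮ (dag-n27-c g16, trigger (t2⁗)) — storey APWᴮ (`…N27AtAllPinsOfRecord13CoPHVCutBFreeLinkReading`, p633778) WITH THE N19′ SLOT AT dag-n19-w3's **BARE LEDGER READING** (NODE O's
# CORE link reading — node N11's idle (iii) block OUT, the reference ledger on the family's lattices, the κ-threshold row OUT — with, in addition, node N16's leaf rows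
# `LeafH3sup` ∕ `sel` (IsMinimiser ∧ RegularSup) taken OUT of NODE O's ∃ and displayed PER TUPLE as `hH3` ∕ `hsel3` in the currency dag-n16-w4's producers CONCLUDE (p607700 §5);
# `…N19RateEdgeHolderD4AtBareLedgerReadingV`: the (v′-16)-free NODE-O obligation at the witness reading, ≈40-line binder): the (B)-free spine body on a regime from K3 v6's four reading pins with every
# remaining slot at its producer, the N19′ face ⟸ dag-n19-w3 g5's ★★★ `keyedCoreEdgeHolderD4BFree_crOfRecord₁₃VAt_of_linkReadingAtBareLedgerReadingV_finiteVolumeRows` (FILE 5b §2: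
# FILE 1 §2's `h19` binder VERBATIM at this `cr`, in THIS lane's finite-volume vocabulary — applied outright).  Versus APWᴮ's displayed rows: `hlink` (≈115-line binder) ↦ `hlinkBareV`
# (≈40 lines: run pins, the `EB` selector, (i) `LedgerAtSync` at the floors `(R.u3.ρ, θ^(3β−2))`, ledger letters, (ii-m)'s cells on `F.P (Koff + K)`, `0 < θ ∧ θ⁶ = L⁻¹`, readings
# rows); `hunif` GONE (⟸ `hs` under the (t-U3) pin); `hρ` DERIVED from `hs`; `hW` ↦ `hWall 0 1`; NEW displayed rows `hκ₀ : kappa₀ (4·2⁴) (2·4) ≤ (ℓ F θ).κ`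
# (the κ-threshold as a U3 LETTER row — dag-n19-w3's located point (2)), `hWall` (W1's (5.10) letter at all 16 pairs), node N16's key-level letters `hradii` ∧ `hclass`, `hβ23 : 2∕3 < β`.
# Sibling of APQᴮ `…VCutBFreeSqueezedLedgerReading` (the squeezed reading, N11's block still displayed).  Composer = FILE 1 §2 `bodyBFree₁₃CoPH_of_keyedFacesP_bFree` (p624138) exactly
# as in APWᴮ; conclusion = the body at every guarded admissible tuple of `Rg` ⇒ (FILE 1 §2∕§3) `Spine (IsRecordOfRecord₁₃CCoPHOn Rg)`, K3⁷'s display, AND K3⁸'s display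
# `SpineGivenEndpointR13SepCoPHV` AT EVERY VERSION SLOT (leaf `…N27SpineGivenEndpointR13SepCoPHVAllPinsOfRecordVBFreeBareLedgerReading`).
# (cell `pub-ymgap`, HUMAN RULING D-0062 Track A, R134 seat `pub-ymgap-dag-n27-c` (N27 B5 composite, s2) gen 16, HOME trigger (t2⁗) «a producer face in a NEW currency at the pins»:
# dag-n19-w3 g5 FILE 5∕5b (CLAIM-5 I.38805, DECL-DELTA-5 I.38904); K3⁸ `SpineGivenEndpointR13SepCoPHV` = stmt-QuantumFields-27366, `--kind proof --supports 27366 --as helper`; COUNT-NEUTRAL; ONE theorem, 0 `def`,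
# 0 `sorry`; `N`-generic, `K₀`-generic, regime-generic, NO Theses import, does NOT import the skeleton or its mirror `K3V6Defs` — v6's `U3PinnedKernels ∕ N15PinnedSized ∕ N16RadiusMatch ∕
# PHolderD4 ∕ rrOfRecord ∕ LiveSel ∕ KeyedCoreEdgeHolderD4BFree` are SPELLED.)

WHAT IS KERNEL-CHECKED ([bookkeeping]; ONE application per regime of FILE 1 §2 at the pinned spine reading: `h20`∕`h21` ⟸ keyed witnesses by dag-n20-d's
`relWeightBound_∕shellWeightBound_crOfRecord₁₃VAt`; `hrates` ⟸ (Kꜰ) §1 `pHolderD4Body_rateCarriers_of_kernels_pin` per tuple and `g₀` from the rows discharged behind the pins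
(`n14At_rateCarriersOfRecord₁₃CoPH_of_pinned`, `n15At_fullGSizedObjects_family`, `rateCarriers_ne3_of_pinnedLoose` + `h16`), the letter rows and dag-n18-w2's door
`u3KernelInputs_of_finiteVolumeLetters` at `hWall 0 1`; `h19` ⟸ dag-n19-w3 g5's FILE 5b §2 at `G := Rg`, `ks := ksel`; `hx` ⟸ UC §0 `keyedExtraction_crOfRecord₁₃VAt_cut` under `hsel`, `hζm`
with (H-U) ∕ `0 ≤ ζ` supplied).
* §1 ★★★ `bodyBFree₁₃CoPH_of_v5pins_bareLedgerReadingV_at_crOfRecord₁₃VAt_cut` — any regime `Rg`, `hsel` per tuple ⇒ the (B)-free body on `Rg`.  Displayed, and NOTHING ELSE: the four pins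
  `hpin1 hpin2 hpinL hpin` · `h16` · `hs hκ hcr hκ₀` · `hr hinc hS h9 hWall` · `hβ23 hβ1` · v6's other two N16 rows `hmatch` (= `N16RadiusMatch ℓ₃ B` spelled) and `hend : N16LettersEnd N g ℓ₃` ·
  N16's key-level letters `hradii hclass` and per-tuple leaf rows `hH3 hsel3` · K1's interval-form window `hβw` · `hsel hζm` · keyed N20 ∕ N21 witnesses `h20 h21` · NODE O's BARE LEDGER
  READING `hlinkBareV` at the pinned spine reading (dag-n19-w3's hypothesis verbatim, `G θ` read `Rg F θ`).
* (no live-line edition in this file; the leaf instantiates §1 at `Rg := guard ∧ LiveSel`, `hsel := ⟨_, hRg.2⟩`.)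
Consumed BY NAME: FILE 1 p624138 §2; UC p595448 §0; dag-n20-d p590105; node00-def-K0c `localBgMeasurable`; dag-n20-w2 `zeta_nonneg_of_provisos₁₃CoPH`; dag-n19-w3 FILE 5b `…AtBareLedgerReadingV` (and through it FILE 5, p638503, p638116,
p636214, p631491, p628905, p607220, dag-n19-w5 p615362 ∕ p616024 ∕ `u3_rateCarriersOfRecord₁₃CoPH_of_pin`, dag-n19-d `latticeLetters_family`); dag-n27-w1 (Kꜰ) §1 p602540; dag-n18-w2 p606911;
dag-n14-w1 ∕ dag-n15-a ∕ dag-n16-e pins and faces.  Nothing landed is edited or re-declared.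

HONEST FRAMING.  COMPOSITE-node bookkeeping BY NAME; a REDUCTION, not a discharge; every displayed antecedent is a HYPOTHESIS inhabited for no family today (K0⁷ `Record13SepCoPHInhabited`
OPEN) or a decided MODEL behind a pin (dag-n14-w1's datum-reading tower; dag-n15-a's model-level sized objects); `hlinkBareV` is NODE O's world at the runs of record (the BARE link-reading
ledger) — UNPRINTED content for d = 4, 0 instances; N11 is NOT READ here (not booked, not discharged); K1's window `hβw` = `stub_betaWindow…`'s currency (K1⁹ OPEN); N16 at the loose-data
object, `hradii ∧ hclass` and `hH3`∕`hsel3` = THE END's ∕ node N16's content (hypotheses; dag-n16-w4's producers conclude `hH3`∕`hsel3`'s shapes); the finite-volume kernel letters, `hκ₀` and `hWall` are Bałaban-type SHAPES NOT PRINTED as such for d = 4; NE7b ∕ NE7c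
witnesses 0∕1 today; `jc sh ℓ s r ℓ₃ g B c' 𝔯 β ksel` FREE PARAMETERS (no reading minted); nothing of Bałaban's or King's asserted or instantiated; NOT `stub_rates13HV` ∕ `stub_expansion13HV`;
N14–N22 ∕ N27 NOT discharged (the chair books, R417); K3⁸ OPEN, NOT claimed; skeleton v6 b4e55110ab73e679 untouched; counts UNMOVED (typed 28∕28 · discharged 5∕27, A 5∕28); one finite
four-torus programme at fixed `ε` — NOT ℝ⁴, NOT infinite volume, NOT OS, NOT a mass gap, NOT Clay.  No decl below carries a cite tag.
-/

set_option autoImplicit false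

namespace Summit.QuantumFields.YangMills.Theorems.BalabanUVNodesN27SpineRecord

open scoped BigOperators Matrix Matrix.Norms.L2Operator
open Finset MeasureTheory
open Literature.MathematicalPhysics.QuantumFieldTheory.Balaban1983to89
open T4OutputRate T4RecentScale T4GoodClassBudget T4CauchySum T4TowerRateComposition T4TowerRateDischarge
open T4EtaRateMin (Readings NE3Shape)
open T4RateLiaison (GaugeDominated)
open FlowStep (RGEqH prefixOf)
open TreeLengthTorus (TFaceConnected torusTreeLen)
open B12TreeDecay (kappa₀)
open Summit.QuantumFields.BalabanUV.T4Continuum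
open AveragingDeficitDualResidual (dualC1 dualC2)
open AveragingDeficitDerivWallProof (wallConst)
open AveragingDeficitPeriodicCounting (IsPeriodicDir)
open MinimalActionSandwich (IsMinimiser minAct)
open MinimalActionRate (sfClass)
open MinimalActionRefine (RegularSup gradConst)
open NE3EnergyShapes (IsUnitarySite IsPeriodicSite)
open NE3.LeafIndexSockets (LeafH3sup)
open Summit.QuantumFields.BalabanUV.T4Continuum.Spine
open Summit.QuantumFields.BalabanUV.T4Continuum.Spine.NE4 (runFlow)
open Summit.QuantumFields.BalabanUV.T4Continuum.NE1p.DressedRoot (DressedTower DressedStabilityStrict)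
open Summit.QuantumFields.YangMills.BalabanUVNodes.N19LedgerLinkSync (LedgerDataSync LedgerAtSync)
open YMDAG.UVSplit
open Summit.QuantumFields.YangMills.BalabanUVNodes.N16HolderDefs (CovRootHolder N16HolderAt)
open Summit.QuantumFields.YangMills.BalabanUVNodes.SpineRatesHolder (RatesHolderAt)
open Literature.MathematicalPhysics.QuantumFieldTheory.Balaban1983to89.T4Continuum (T4Family ULoop)
open Node00 (Stage13HParams datumOfRecord₁₃CoPH SiteSeqKey U3Letters₁₁ NE3Letters₁₁ ne3ConstLayerOfRecord₁₁ ne3NperOfRecord₁₁ ne3DomOfRecord₁₁ ZetaMeasurable ppSelLiveOfRecord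
  EOfRecord₁₃ wOfRecord₉ localBgMeasurable)
open Literature.MathematicalPhysics.QuantumFieldTheory.Balaban1983to89.B12Sec2to5 (betaPrime510)
open Literature.MathematicalPhysics.QuantumFieldTheory.Balaban1983to89.Node00.U3OfKernels (objectsOfRecord₁₃ KernelDecayOfRecord₁₃)
open Literature.MathematicalPhysics.QuantumFieldTheory.Balaban1983to89.Node00.U3KernelLetters (GeometricIncrementsOfRecord₁₃ WindowedNE9OfRecord₁₃ WindowedDecayOfRecord₁₃
  WindowedStepRateOfRecord₁₃)
open Summit.QuantumFields.YangMills.BalabanUVNodes.N16PinnedLayer13CoPH (N16PinnedLoose N16LettersEnd rateCarriers_ne3_of_pinnedLoose)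
open T4WeightBudget (RelWeightBound)
open T4IndicatorShell (ShellWeightBound)
open T4ContinuumYM4Torus (ForSmallCouplings)
open T4ApexHybrid (HybridNE7Under StringwiseHybridNE7)
open Summit.QuantumFields.YangMills.BalabanUVNodes.N19CoreEdgeFSCComposer (keyedGuarded₁₃CoPH_of_keyedFacesP_fsc)
open Summit.QuantumFields.YangMills.BalabanUVNodes.N19RateEdgeHolderD4AtBareLedgerReadingV (keyedCoreEdgeHolderD4BFree_crOfRecord₁₃VAt_of_linkReadingAtBareLedgerReadingV_finiteVolumeRows)
open Summit.QuantumFields.YangMills.BalabanUVNodes.SpineCanonicalWeights (core_nonneg_of_shellWeightBound)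
open Summit.QuantumFields.YangMills.BalabanUVNodes.N19TargetClassWeightsE1Keyed
open Summit.QuantumFields.YangMills.BalabanUVNodes.N21KeyedShellWeightShellZero (zeta_nonneg_of_provisos₁₃CoPH)
open YMDAG.N14.TopBorn (Ne1PinnedOfRecord n14At_rateCarriersOfRecord₁₃CoPH_of_pinned)
open Summit.QuantumFields.YangMills.BalabanUVNodes.N15.GenuineRecord (fullGSizedObjects n15At_fullGSizedObjects_family)
open Summit.QuantumFields.YangMills.BalabanUVNodes.N15.AtKeyedHome (neZero_blockFactor)
open YMDAG.N18.PolLimitRate (u3KernelInputs_of_finiteVolumeLetters)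

variable {N : ℕ} [NeZero N] (K₀ : ℕ)
  (jc : (F : T4Family) → (θ : Stage13HParams F N) → θ.Provisos₁₃CoPH F N → (ℕ → ℝ) → List (ULoop F) → ℕ → ℕ)
  (sh : ShellSplit₁₃CoPH N K₀) (β : ℝ) (𝔯 : RateReading₁₃CoPH N)
  (ℓ : (F : T4Family) → Stage13HParams F N → U3Letters₁₁) (s : (F : T4Family) → Stage13HParams F N → ℕ) (r : (F : T4Family) → Stage13HParams F N → ℝ)
  (ℓ₃ : T4Family → NE3Letters₁₁) (g B c' : T4Family → ℝ)

/-! ## §1 Every v6 slot at its producer, K5 at the per-tuple-cut spine reading of record, N19′ ⟸ the BARE LEDGER READING at that reading (any regime, `hsel` per tuple) -/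

/-- ★★★ **APBᴮ — THE (B)-FREE SPINE BODY ON A REGIME FROM ALL FOUR PINS WITH EVERY REMAINING SLOT AT ITS PRODUCER, N19′ AT THE BARE LEDGER READING**: FILE 1 §2
`bodyBFree₁₃CoPH_of_keyedFacesP_bFree` at the PINNED spine reading `fun F θ hP g₀ os ↦ crOfRecord₁₃VAt K₀ (jc F θ hP g₀ os) sh F θ hP g₀ os` with: the rates' `PHolderD4 β` body per tuple by
(Kꜰ) §1 `pHolderD4Body_rateCarriers_of_kernels_pin` from the FOUR reading pins (`hpin1 hpin2 hpinL hpin`; rows discharged behind them), `h16`, the U3 letter rows `hs hκ hcr` (`0 ≤ ρ < 1` from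
`hs`) and dag-n18-w2's finite-volume door (`hr hinc hS h9`, `hWall 0 1` ⇒ `hdec h18 h22`); N20 ∕ N21 from keyed witnesses `h20 h21` by dag-n20-d's transfers; N27x a THEOREM (UC §0 under `hsel`,
`hζm`); and the N19′ face ⟸ dag-n19-w3 g5's ★★★ `keyedCoreEdgeHolderD4BFree_crOfRecord₁₃VAt_of_linkReadingAtBareLedgerReadingV_finiteVolumeRows` (FILE 5b §2) AT THIS READING from the three
pins, the U3 letter row `hκ₀ : kappa₀ (4·2⁴) (2·4) ≤ (ℓ F θ).κ`, `hmatch hend hradii hclass`, node N16's per-tuple leaf rows `hH3 hsel3` (p607700 §5's currency), `2∕3 < β ≤ 1`, `hβw`, `hs hr hinc h9 hWall`, and NODE O's BARE LEDGER READING `hlinkBareV` (their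
displayed hypothesis verbatim; 0 instances in the tree).  So the (B)-free body on `Rg` costs EXACTLY the displayed rows — pins · `h16` · letter rows incl. `hκ₀` · finite-volume kernel letters
incl. `hWall` · `hβ23 hβ1 hmatch hend hradii hclass hH3 hsel3 hβw` · `hsel hζm` · keyed `h20 h21` · `hlinkBareV` — and NOTHING parametric is left.  Every row a HYPOTHESIS or a decided MODEL (0∕1 today;
K0⁷ OPEN); `hlinkBareV` = NODE O's world (UNPRINTED content); N11 NOT READ; nothing of Bałaban's proved; NOT `stub_rates13HV` ∕ `stub_expansion13HV`; no node discharged. [bookkeeping] -/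
theorem bodyBFree₁₃CoPH_of_v5pins_bareLedgerReadingV_at_crOfRecord₁₃VAt_cut (Rg : (F : T4Family) → Stage13HParams F N → Prop)
    (ksel : (F : T4Family) → (θ : Stage13HParams F N) → θ.Provisos₁₃CoPH F N → (ℕ → ℝ) → List (ULoop F) → ℕ)
    (hpin1 : Ne1PinnedOfRecord 𝔯)
    (hpin2 : ∃ (b aS : ℝ) (ν μ α β' : Fin 4) (c35 p : ℝ), 0 < b ∧ 0 < aS ∧
      ∀ (F : T4Family) (θ : Stage13HParams F N) (hP : θ.Provisos₁₃CoPH F N) (g₀ : ℕ → ℝ) (os : List (ULoop F)) (k : ℕ),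
        (𝔯.lit F θ hP g₀ os).ne2 k = haveI := neZero_blockFactor F; fullGSizedObjects 3 F.hL b aS ν μ α β' c35 p)
    (hpinL : N16PinnedLoose 𝔯 ℓ₃ B)
    (hpin : ∀ (F : T4Family) (θ : Stage13HParams F N) (hP : θ.Provisos₁₃CoPH F N) (g₀ : ℕ → ℝ) (os : List (ULoop F)),
      (𝔯.lit F θ hP g₀ os).u3 = objectsOfRecord₁₃ F N θ.toStage13Params (ℓ F θ))
    (h16 : ∀ (F : T4Family), (∃ θ : Stage13HParams F N, θ.Provisos₁₃CoPH F N ∧ Rg F θ ∧ θ.Admissible F N) →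
      N16HolderAt (ne3OfRecord₁₁ F { ne3ConstLayerOfRecord₁₁ F N (ℓ₃ F) with
        dom := {V | V ∈ ne3DomOfRecord₁₁ F N 0 0 ∧ V ∈ sfClass 4 F.L (ne3NperOfRecord₁₁ F 0 0) ((ℓ₃ F).ε / B F) 0} }) β)
    (hs : ∀ (F : T4Family) (θ : Stage13HParams F N), θ.Provisos₁₃CoPH F N → Rg F θ → θ.Admissible F N → (ℓ F θ).Signs)
    (hκ : ∀ (F : T4Family) (θ : Stage13HParams F N), θ.Provisos₁₃CoPH F N → Rg F θ → θ.Admissible F N → 0 < (ℓ F θ).κ)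
    (hcr : ∀ (F : T4Family) (θ : Stage13HParams F N), θ.Provisos₁₃CoPH F N → Rg F θ → θ.Admissible F N →
      betaPrime510 4 1 (ℓ F θ).κ ≤ (ℓ F θ).cr)
    (hκ₀ : ∀ (F : T4Family) (θ : Stage13HParams F N), θ.Provisos₁₃CoPH F N → Rg F θ → θ.Admissible F N → kappa₀ (4 * 2 ^ 4) (2 * 4) ≤ (ℓ F θ).κ)
    (hr : ∀ (F : T4Family) (θ : Stage13HParams F N), θ.Provisos₁₃CoPH F N → Rg F θ → θ.Admissible F N → r F θ < 1)
    (hinc : ∀ (F : T4Family) (θ : Stage13HParams F N), θ.Provisos₁₃CoPH F N → Rg F θ → θ.Admissible F N →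
      GeometricIncrementsOfRecord₁₃ F N θ.toStage13Params (r F θ))
    (hS : ∀ (F : T4Family) (θ : Stage13HParams F N), θ.Provisos₁₃CoPH F N → Rg F θ → θ.Admissible F N →
      WindowedStepRateOfRecord₁₃ F N θ.toStage13Params (s F θ) (ℓ F θ).κ (ℓ F θ).θ₅ ((ℓ F θ).C₅ * (ℓ F θ).θ₅))
    (h9 : ∀ (F : T4Family) (θ : Stage13HParams F N), θ.Provisos₁₃CoPH F N → Rg F θ → θ.Admissible F N →
      WindowedNE9OfRecord₁₃ F N θ.toStage13Params (ℓ F θ).κ (ℓ F θ).moduli)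
    (hWall : ∀ (μ ν : Fin 4) (F : T4Family) (θ : Stage13HParams F N), θ.Provisos₁₃CoPH F N → Rg F θ → θ.Admissible F N →
      WindowedDecayOfRecord₁₃ F N θ.toStage13Params μ ν (ℓ F θ).κ)
    (hβ23 : 2 / 3 < β) (hβ1 : β ≤ 1)
    (hmatch : ∀ F : T4Family, 0 < B F ∧ (ℓ₃ F).ε / B F ≤ (ℓ₃ F).b)
    (hend : N16LettersEnd N g ℓ₃)
    (hradii : ∀ F : T4Family, (ℓ₃ F).g = gradConst 4 (c' F) ∧ 0 ≤ c' F ∧ 0 < c' F ∧ (ℓ₃ F).b ≤ c' F ∧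
      (2 : ℝ) ^ 91 * (F.L : ℝ) ^ 17 * c' F ≤ 1 ∧ (2 : ℝ) ^ 76 * (F.L : ℝ) ^ 12 * c' F ≤ (ℓ₃ F).ε ∧ (ℓ₃ F).ε / B F ≤ 1 / 4 ∧ 4 * ((ℓ₃ F).ε / B F) ≤ c' F)
    (hclass : ∀ F : T4Family, 16 * B7Prop2Explicit.C0 4 * (ℓ₃ F).ε ≤ 3 ∧ 1024 * (4 + 1) * (4 + 4) * (F.L : ℝ) ^ 2 * (ℓ₃ F).ε ≤ 1)
    (hH3 : ∀ (F : T4Family) (θ : Stage13HParams F N) (hP : θ.Provisos₁₃CoPH F N) (g₀ : ℕ → ℝ) (os : List (ULoop F)) (k : ℕ),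
      LeafH3sup 4 (rateCarriersOfRecord₁₃CoPH 𝔯 F θ hP g₀ os k).ne3.L (rateCarriersOfRecord₁₃CoPH 𝔯 F θ hP g₀ os k).ne3.Nper (rateCarriersOfRecord₁₃CoPH 𝔯 F θ hP g₀ os k).ne3.ε
        (rateCarriersOfRecord₁₃CoPH 𝔯 F θ hP g₀ os k).ne3.b (c' F) (rateCarriersOfRecord₁₃CoPH 𝔯 F θ hP g₀ os k).ne3.dom)
    (hsel3 : ∀ (F : T4Family) (θ : Stage13HParams F N) (hP : θ.Provisos₁₃CoPH F N) (g₀ : ℕ → ℝ) (os : List (ULoop F)) (k : ℕ),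
      ∃ sel : ℕ → (B7Prop1Explicit.Site 4 → Fin 4 → (Matrix (Fin N) (Fin N) ℂ)ˣ) → (B7Prop1Explicit.Site 4 → Fin 4 → (Matrix (Fin N) (Fin N) ℂ)ˣ),
        (∀ V ∈ (rateCarriersOfRecord₁₃CoPH 𝔯 F θ hP g₀ os k).ne3.dom, ∀ j : ℕ,
          IsMinimiser 4 (sfClass 4 (rateCarriersOfRecord₁₃CoPH 𝔯 F θ hP g₀ os k).ne3.L (rateCarriersOfRecord₁₃CoPH 𝔯 F θ hP g₀ os k).ne3.Nper (rateCarriersOfRecord₁₃CoPH 𝔯 F θ hP g₀ os k).ne3.ε)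
            (rateCarriersOfRecord₁₃CoPH 𝔯 F θ hP g₀ os k).ne3.L (rateCarriersOfRecord₁₃CoPH 𝔯 F θ hP g₀ os k).ne3.Nper j V (sel j V)) ∧
        (∀ V ∈ (rateCarriersOfRecord₁₃CoPH 𝔯 F θ hP g₀ os k).ne3.dom, ∀ j : ℕ,
          RegularSup 4 (rateCarriersOfRecord₁₃CoPH 𝔯 F θ hP g₀ os k).ne3.L (rateCarriersOfRecord₁₃CoPH 𝔯 F θ hP g₀ os k).ne3.Nper (rateCarriersOfRecord₁₃CoPH 𝔯 F θ hP g₀ os k).ne3.b (c' F) j (sel j V)))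
    (hβw : ∀ (F : T4Family) (θ : Stage13HParams F N) (hP : θ.Provisos₁₃CoPH F N), Rg F θ → θ.Admissible F N →
      ∃ γ₀ b b' : ℝ, 0 < γ₀ ∧ 0 < b ∧ DagBinding.BetaBoundsInInterval (datumOfRecord₁₃CoPH F N θ hP).C.toB12 γ₀ b b')
    (hsel : ∀ (F : T4Family) (θ : Stage13HParams F N), θ.Provisos₁₃CoPH F N → Rg F θ → θ.Admissible F N →
      ∃ E : B12.RunParams → ℝ, θ.ppSel = ppSelLiveOfRecord F N θ.ν θ.τ9 E (wOfRecord₉ F N θ.toStage9Params))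
    (hζm : ∀ (F : T4Family) (θ : Stage13HParams F N), θ.Provisos₁₃CoPH F N → Rg F θ → θ.Admissible F N → ZetaMeasurable F N θ.ζ)
    (h20 : ∀ (F : T4Family) (θ : Stage13HParams F N) (hP : θ.Provisos₁₃CoPH F N), Rg F θ → θ.Admissible F N →
      ∀ (g₀ : ℕ → ℝ) (os : List (ULoop F)),
        ∃ W : ℕ → ℝ, RelWeightBound 1 (classSet₁₃ θ K₀ g₀) (weightA₁₃ θ hP K₀ g₀ os) (weightB₁₃ θ hP K₀ g₀ os) (badClass₁₃ θ K₀ g₀ (jc F θ hP g₀ os)) W)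
    (h21 : ∀ (F : T4Family) (θ : Stage13HParams F N) (hP : θ.Provisos₁₃CoPH F N), Rg F θ → θ.Admissible F N →
      ∀ (g₀ : ℕ → ℝ) (os : List (ULoop F)),
        ∃ Wsh : ℕ → ℝ, ShellWeightBound 1 (classSet₁₃ θ K₀ g₀) (weightA₁₃ θ hP K₀ g₀ os) (weightB₁₃ θ hP K₀ g₀ os) (sh F θ hP g₀ os).1 (sh F θ hP g₀ os).2 Wsh)
    (hlinkBareV : ∀ (F : T4Family) (θ : Stage13HParams F N) (hP : θ.Provisos₁₃CoPH F N), Rg F θ → θ.Admissible F N →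
      ∀ (γ gIR b : ℝ) (g₀ : ℕ → ℝ), (datumOfRecord₁₃CoPH F N θ hP).Tuned γ gIR g₀ → γ ≤ θ.γ → γ ^ 2 ≤ Real.exp (-1) → 0 < b →
      (∀ K m, 0 ≤ m → m < K → b ≤ (datumOfRecord₁₃CoPH F N θ hP).βfun m (prefixOf (runFlow (datumOfRecord₁₃CoPH F N θ hP) g₀ K) m)) →
      ∀ (os : List (ULoop F)) (k : ℕ),
      let S : SpineCarriers := crOfRecord₁₃VAt K₀ (jc F θ hP g₀ os) sh F θ hP g₀ os
      let R : RateCarriers N := rateCarriersOfRecord₁₃CoPH 𝔯 F θ hP g₀ os k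
      let D : Datum F N := datumOfRecord₁₃CoPH F N θ hP
      letI := S.dec
      ∃ (_ : DecidableEq R.u3.C.Dom) (F' : Type) (ι' X' : Type) (_ : MeasurableSpace ι')
        (L : LedgerDataSync R.u3.C F' ι' S.ι) (Rd : Readings ι' X') (bsel : (ℕ → ℝ) → ℝ) (EB : Functional R.u3.C R.u3.C.BgB)
        (g : ℕ → ℕ → ℝ)
        (uA : ℕ → ι' → R.u3.C.BgA) (uB : ℕ → ι' → R.u3.C.BgB)
        (Koff : ℕ) (cells : (K j : ℕ) → R.u3.C.Dom → Finset (Site (F.P (Koff + K)) j))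
        (θ : ℝ)
        (rd : ι' → (B7Prop1Explicit.Site 4 → Fin 4 → (Matrix (Fin N) (Fin N) ℂ)ˣ)),
        (∀ K i, i ≤ K → g K i = runFlow D g₀ K i) ∧ (∀ K i, K < i → g K i = gIR) ∧
        EB = (fun s => R.u3.EB (bsel s) s) ∧
        (∀ (Sz : ℕ → ℝ → S.ι → ℕ → ℝ) (E₀ : ℝ) (m : ℕ) (a : ℝ) (Cw Λg : ℝ),
          (∀ K t, |t| ≤ S.l₀ → ∀ τ ∈ S.T K \ S.Bad K t, ∀ v ∈ Rd.dom, ∀ j ≤ K,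
            |∑ X ∈ L.fac K t τ with R.u3.C.scale X = j,
                (Real.log (Real.exp (EB (fun i => g (K + 1) (i + 1)) (uB K v) X
                    - EB (fun i => g (K + 1) (i + 1)) L.oneB X))
                  - Real.log (Real.exp (R.u3.EA (g K) (uA K v) X - R.u3.EA (g K) L.oneA X)))| ≤ Sz K t τ j) →
          0 ≤ E₀ → 0 < a → a < 1 →
          (∀ K t, |t| ≤ S.l₀ → ∀ τ ∈ S.T K \ S.Bad K t, ∀ j ≤ K,
            Sz K t τ j ≤ S.vol * (E₀ * ((K : ℝ) + 1) ^ m * a ^ (K - j))) →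
          (∀ K, Multiplicity (L.All K) R.u3.C.scale (fun X => Real.exp (-(R.u3.κ * R.u3.C.d X))) Cw S.vol Λg K) →
          (∀ K t, |t| ≤ S.l₀ → ∀ τ ∈ S.T K \ S.Bad K t,
            WindowMultiplicity (L.facO K t τ) L.scO L.wO Cw S.vol Λg (jlogOf L.Cl K) K) →
          1 ≤ Λg → L.θ' ≤ Λg →
          LedgerAtSync { L with S := Sz, E₀ := E₀, m := m, a := a, Cw := Cw, Λg := Λg } S.l₀ S.vol S.T S.Bad
            (fun K t τ => S.A K t τ - S.shA K t τ) (fun K t τ => S.B K t τ - S.shB K t τ) Rd R.u3.EA EB R.u3.κ g uA uB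
            R.u3.ω R.u3.ρ R.u3.θ (θ ^ ((3 : ℝ) * β - 2))) ∧
        (∀ K t, |t| ≤ S.l₀ → ∀ τ ∈ S.T K \ S.Bad K t,
          WindowMultiplicity (L.facO K t τ) L.scO L.wO L.Cw S.vol L.Λg (jlogOf L.Cl K) K) ∧
        0 ≤ L.Cw ∧ 1 ≤ L.Λg ∧ L.θ' ≤ L.Λg ∧
        (∀ K, ∀ X ∈ L.All K,
          (cells K (R.u3.C.scale X + Koff) X).Nonempty ∧ TFaceConnected (cells K (R.u3.C.scale X + Koff) X)) ∧
        (∀ K j, Set.InjOn (cells K j) ↑((L.All K).filter fun X => R.u3.C.scale X + Koff = j)) ∧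
        (∀ K, ∀ X ∈ L.All K, torusTreeLen (cells K (R.u3.C.scale X + Koff) X) ≤ R.u3.C.d X) ∧
        0 < θ ∧ θ ^ 6 = ((R.ne3.L : ℝ))⁻¹ ∧
        (∀ v ∈ Rd.dom, rd v ∈ R.ne3.dom) ∧
        (∀ k, ∀ v ∈ Rd.dom, Rd.act k v = minAct 4 (sfClass 4 R.ne3.L R.ne3.Nper R.ne3.ε) R.ne3.L R.ne3.Nper k (rd v)) ∧
        (R.ne3.Nper : ℝ) ^ 4 ≤ Rd.vol ∧
        (∀ s ∈ Window γ, 0 < bsel s ∧ bsel s ≤ γ))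
    (F : T4Family) (θ : Stage13HParams F N) (hP : θ.Provisos₁₃CoPH F N) (hRg : Rg F θ) (hθ : θ.Admissible F N) :
    ForSmallCouplings (datumOfRecord₁₃CoPH F N θ hP) fun g₀ => StringwiseHybridNE7 ((datumOfRecord₁₃CoPH F N θ hP).scheme g₀) := by
  have hρ : ∀ (F : T4Family) (θ : Stage13HParams F N), θ.Provisos₁₃CoPH F N → Rg F θ → θ.Admissible F N →
      0 ≤ (ℓ F θ).ρ ∧ (ℓ F θ).ρ < 1 := fun F θ hP hRg hθ => ⟨(hs F θ hP hRg hθ).ρ_nonneg, (hs F θ hP hRg hθ).ρ_lt_one⟩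
  have hU := fun (F : T4Family) (θ : Stage13HParams F N) (hP : θ.Provisos₁₃CoPH F N) (hRg : Rg F θ) (hθ : θ.Admissible F N) =>
    u3KernelInputs_of_finiteVolumeLetters F N θ.toStage13Params (ℓ F θ) (hs F θ hP hRg hθ) (s F θ) (hr F θ hP hRg hθ) (hinc F θ hP hRg hθ) (hS F θ hP hRg hθ)
      (h9 F θ hP hRg hθ) (hWall 0 1 F θ hP hRg hθ)
  exact bodyBFree₁₃CoPH_of_keyedFacesP_bFree (fun F θ hP g₀ os => crOfRecord₁₃VAt K₀ (jc F θ hP g₀ os) sh F θ hP g₀ os)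
      (fun F θ hP g₀ os => rateCarriersOfRecord₁₃CoPH 𝔯 F θ hP g₀ os (ksel F θ hP g₀ os)) Rg
      (fun D R => RatesHolderAt D R β ∧ ReadOutAt D R.u3 ∧ (0 ≤ R.u3.ρ ∧ R.u3.ρ < 1))
      (fun F θ hP hRg hθ g₀ os => by
        obtain ⟨W, hW⟩ := h20 F θ hP hRg hθ g₀ os
        exact relWeightBound_crOfRecord₁₃VAt K₀ (jc F θ hP g₀ os) sh θ hP g₀ os hW)
      (fun F θ hP hRg hθ g₀ os => by
        obtain ⟨Wsh, hWsh⟩ := h21 F θ hP hRg hθ g₀ os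
        exact shellWeightBound_crOfRecord₁₃VAt K₀ (jc F θ hP g₀ os) sh θ hP g₀ os hWsh)
      (fun F θ hP hRg hθ => ForSmallCouplings.of_forall fun g₀ os =>
        pHolderD4Body_rateCarriers_of_kernels_pin 𝔯 θ hP g₀ os (ℓ F θ) (hpin F θ hP g₀ os) β (ksel F θ hP g₀ os)
          (n14At_rateCarriersOfRecord₁₃CoPH_of_pinned 𝔯 hpin1 F θ hP g₀ os (ksel F θ hP g₀ os))
          (by
            obtain ⟨b, aS, ν, μ, α, β', c35, p, hb, haS, h⟩ := hpin2
            rw [h F θ hP g₀ os]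
            exact n15At_fullGSizedObjects_family hb haS ν μ α β' c35 p F)
          (by
            show N16HolderAt (rateCarriersOfRecord₁₃CoPH 𝔯 F θ hP g₀ os (ksel F θ hP g₀ os)).ne3 β
            rw [rateCarriers_ne3_of_pinnedLoose hpinL F θ hP g₀ os (ksel F θ hP g₀ os)]
            exact h16 F ⟨θ, hP, hRg, hθ⟩)
          (hs F θ hP hRg hθ) (hκ F θ hP hRg hθ) (hcr F θ hP hRg hθ) (hρ F θ hP hRg hθ) (hU F θ hP hRg hθ).1 ((hU F θ hP hRg hθ).2.1 _)
          ((hU F θ hP hRg hθ).2.2 _))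
      (keyedCoreEdgeHolderD4BFree_crOfRecord₁₃VAt_of_linkReadingAtBareLedgerReadingV_finiteVolumeRows K₀ jc sh 𝔯 (fun θ => Rg _ θ) hβ1 hlinkBareV hβ23 hpin1 ℓ hpin hκ₀ hpinL hmatch hend hradii hclass hH3 hsel3 hs r hr hinc h9 hWall ksel hβw)
      (fun F θ hP hRg hθ => by
        obtain ⟨E, hE⟩ := hsel F θ hP hRg hθ
        exact keyedExtraction_crOfRecord₁₃VAt_cut K₀ jc sh θ hP E hE (localBgMeasurable F N θ.ν) (hζm F θ hP hRg hθ) (zeta_nonneg_of_provisos₁₃CoPH F θ hP))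
      F θ hP hRg hθ

end Summit.QuantumFields.YangMills.Theorems.BalabanUVNodesN27SpineRecord
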